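import Summits.Ventures.PercRepro.PerFlatTransfer
import Summits.Ventures.PercRepro.RankLevelSetFrameQ
import Summits.Ventures.PercRepro.TheoremOAll
import Summits.Ventures.PercRepro.SixThreeFinal

/-!
# PercRepro — the lifted rule `R₃⁺` on Mathlib matroids: definition, the per-flat Prop of the `(p, 3)` lane,
the kernel reduction of C-025 at `q = 3` to it, and the rule's share bounds (night-3, gen 3)

The certificate-lifting lane of C-025 at `q = 3` (`proofs/N3-R3PLUS-plan.md`, `mining/night-3/README.md` §THE RULE)
charges every middle-level set `S` (`3 < ρ(S) < p`) to the planes `G` of `M` through the trace `G ∩ S`: a trace of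
one of the six small types `𝒯₀` (rank `3`, at most `5` points, no `4`-point line) weighs `ρ₃(G ∩ S)` = its number of
independent triples; as soon as some trace is OUTSIDE `𝒯₀`, the largest such traces take everything, split in
proportion to `ρ₃` ("lexicographic hard max").  This file puts the rule on Mathlib's `Matroid` and plugs it into
the cell's kernel frame, so that the lane's gap is ONE Lean `Prop`:

* `rho3 M F` (`ρ₃`), `HasLongLine`, `NonT0` (a trace outside `𝒯₀`), `mstar M S` (`m*`: the largest non-`𝒯₀` trace
  size, `0` if none), `fPlus` (the unnormalised weight), **`wPlus M G S`** (the `R₃⁺` share of the plane `G` in `S`,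
  normalised over `flatsQ M 3` as in `PerFlatTransfer.lean`); `sum_wPlus_le_one`: it is a rule;
* **`R3PlusPerFlat p`** — the per-flat inequality of the lane at `(p, 3)` on the `q = 3` CORE of night-1's frame
  (simple, rank `p`, coloop-free, every element with an `e`-free partition: `Core`): every plane `G` receives at least
  `Φ(p, 3) · #U_G`;
* **`c025_three_of_R3Plus`** — the REDUCTION: `C025` at `q = 3` for every finite matroid and every `p ≥ 5` follows from
  the `(7, 3)` core and `R3PlusPerFlat p` for all `p ≥ 8` — through `ThmN.c025_three_of_core` (`RankLevelSetFrameQ`),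
  `PerFlat.c025_of_perFlat_normalized` (`PerFlatTransfer`), `c025_five_three` (`TheoremOAll`) and
  `SixThree.c025_six_three` (`SixThreeFinal`).  So the lane's paper candidate «`R₃⁺` is a per-flat certificate at
  `(p, 3)` for every `p ≥ 8`» is exactly `∀ p ≥ 8, R3PlusPerFlat p`, and nothing else is missing on the frame side
  except the `(7, 3)` core (paper, `θ = 6`);
* the SHARE BOUNDS of the rule, the arithmetic half of the lane's paper item (P2): `sum_rho3_inter` (every independent
  triple of `S` lies in exactly one plane, `Σ_G ρ₃(G ∩ S) = ρ₃(S)`), `rho3_le_choose`, and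
  `wPlus_ge_of_mstar_zero`: with no trace outside `𝒯₀`, `w⁺(G, S) ≥ ρ₃(G ∩ S) / C(|S|, 3)` (the pure-form share
  `ρ₃(B′)/C(b + x, 3)` of the lane for every `B′ ⊆ G ∩ S`, `wPlus_ge_of_subset_of_mstar_zero`);
  `wPlus_eq_one_of_unique`: a unique largest non-`𝒯₀` trace takes the whole unit mass (the «winner» share `1`);
  `wPlus_ge_of_tie`: `k` tied largest traces of no larger `ρ₃` leave `G` at least `1/k` (the near-pencil tie
  `1/(x + 1)`).  What stays on paper is the GEOMETRY — which traces occur in a witness of the reduced world.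
Imports the cell's `PerFlatTransfer`, `RankLevelSetFrameQ`, `TheoremOAll`, `SixThreeFinal`.  Axioms: standard.
-/

namespace PercRepro

namespace NightThree

open Finset ThmH PerFlat

variable {α : Type*} [DecidableEq α] {M : Matroid α} [M.Finite]

/-! ### `ρ₃` and the trace types -/

open scoped Classical in
/-- `ρ₃(F)`: the number of independent `3`-subsets of the finset `F`. -/
noncomputable def rho3 (M : Matroid α) (F : Finset α) : ℕ :=
  ((F.powersetCard 3).filter (fun (T : Finset α) => M.Indep (T : Set α))).card

omit [DecidableEq α] [M.Finite] in
/-- `ρ₃` is monotone. -/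
theorem rho3_mono {B F : Finset α} (h : B ⊆ F) : rho3 M B ≤ rho3 M F := by
  classical
  unfold rho3
  exact Finset.card_le_card (Finset.filter_subset_filter _ (Finset.powersetCard_mono h))

omit [DecidableEq α] [M.Finite] in
/-- `ρ₃(F) ≤ C(|F|, 3)`. -/
theorem rho3_le_choose (F : Finset α) : rho3 M F ≤ F.card.choose 3 := by
  classical
  unfold rho3
  exact (Finset.card_filter_le _ _).trans (by rw [Finset.card_powersetCard])

omit [DecidableEq α] [M.Finite] in
/-- An independent `3`-subset has rank `3`. -/
theorem eRk_eq_three_of_indep_card {T : Finset α} (hT : M.Indep (T : Set α)) (hc : T.card = 3) :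
    M.eRk (T : Set α) = 3 := by
  rw [hT.eRk_eq_encard, Set.encard_coe_eq_coe_finsetCard, hc]
  rfl

omit [DecidableEq α] [M.Finite] in
/-- A set of rank `3` has at least `3` points. -/
theorem three_le_card_of_eRk_eq_three {F : Finset α} (h3 : M.eRk (F : Set α) = 3) : 3 ≤ F.card := by
  have h := M.eRk_le_encard (F : Set α)
  rw [h3, Set.encard_coe_eq_coe_finsetCard] at h
  exact_mod_cast h

omit [DecidableEq α] in
/-- A rank-`3` subset of the ground set has an independent triple: `ρ₃ > 0`. -/
theorem rho3_pos_of_eRk_eq_three {F : Finset α} (hF : F ⊆ gr M) (h3 : M.eRk (F : Set α) = 3) :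
    0 < rho3 M F := by
  have hFE : (F : Set α) ⊆ M.E := by rw [← coe_gr M]; exact_mod_cast hF
  obtain ⟨I, hI⟩ := M.exists_isBasis (F : Set α) hFE
  have hIfin : I.Finite := F.finite_toSet.subset hI.subset
  have hIc : I.encard = 3 := by rw [hI.encard_eq_eRk, h3]
  have hTc : hIfin.toFinset.card = 3 := by
    have := hIc
    rw [← hIfin.coe_toFinset, Set.encard_coe_eq_coe_finsetCard] at this
    exact_mod_cast this
  classical
  unfold rho3
  apply Finset.card_pos.2
  refine ⟨hIfin.toFinset, ?_⟩
  simp only [Finset.mem_filter, Finset.mem_powersetCard]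
  refine ⟨⟨?_, hTc⟩, ?_⟩
  · rw [← Finset.coe_subset, hIfin.coe_toFinset]; exact hI.subset
  · rw [hIfin.coe_toFinset]; exact hI.indep

/-- `F` contains a `4`-point set of rank `≤ 2` (a line with at least `4` points). -/
def HasLongLine (M : Matroid α) (F : Finset α) : Prop :=
  ∃ L ∈ F.powersetCard 4, M.eRk (L : Set α) ≤ 2

/-- `F` is a trace OUTSIDE the six small types `𝒯₀`: rank `3` and (`≥ 6` points or a `4`-point line). -/
def NonT0 (M : Matroid α) (F : Finset α) : Prop :=
  M.eRk (F : Set α) = 3 ∧ (6 ≤ F.card ∨ HasLongLine M F)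

/-! ### The rule `R₃⁺` -/

open scoped Classical in
/-- `m*(S)`: the largest size of a non-`𝒯₀` trace `G ∩ S` over the planes `G` of `M` (`0` if there is none). -/
noncomputable def mstar (M : Matroid α) [M.Finite] (S : Finset α) : ℕ :=
  ((flatsQ M 3).filter (fun G => NonT0 M (G ∩ S))).sup (fun G => (G ∩ S).card)

open scoped Classical in
/-- The unnormalised `R₃⁺` weight of the plane `G` in the set `S`: `ρ₃(G ∩ S)` when every trace is in `𝒯₀`;
otherwise `ρ₃(G ∩ S)` if `G ∩ S` is a non-`𝒯₀` trace of the largest size and `0` else. -/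
noncomputable def fPlus (M : Matroid α) [M.Finite] (G S : Finset α) : ℚ :=
  if mstar M S = 0 then (rho3 M (G ∩ S) : ℚ)
  else if NonT0 M (G ∩ S) ∧ (G ∩ S).card = mstar M S then (rho3 M (G ∩ S) : ℚ) else 0

/-- The `R₃⁺` share of the plane `G` in `S`: `fPlus` normalised over the planes (`0` when nothing is charged). -/
noncomputable def wPlus (M : Matroid α) [M.Finite] (G S : Finset α) : ℚ :=
  fPlus M G S / ∑ G' ∈ flatsQ M 3, fPlus M G' S

/-- The weights are nonnegative. -/
theorem fPlus_nonneg (M : Matroid α) [M.Finite] (G S : Finset α) : 0 ≤ fPlus M G S := by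
  unfold fPlus
  split_ifs <;> positivity

/-- The shares are nonnegative. -/
theorem wPlus_nonneg (M : Matroid α) [M.Finite] (G S : Finset α) : 0 ≤ wPlus M G S := by
  unfold wPlus
  exact div_nonneg (fPlus_nonneg M G S) (Finset.sum_nonneg (fun G' _ => fPlus_nonneg M G' S))

/-- `R₃⁺` is a rule: `Σ_G w⁺(G, S) ≤ 1`. -/
theorem sum_wPlus_le_one (M : Matroid α) [M.Finite] (S : Finset α) :
    ∑ G ∈ flatsQ M 3, wPlus M G S ≤ 1 :=
  sum_normalized_le_one 3 (fPlus M) (fPlus_nonneg M) S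

/-! ### The per-flat Prop and the reduction -/

omit [DecidableEq α] [M.Finite] in
/-- The `q = 3` CORE of night-1's frame (`ThmN.c025_three_of_core`): simple, rank `p`, coloop-free, every element
with an `e`-free partition. -/
def Core (M : Matroid α) (p : ℕ) : Prop :=
  (∀ e ∈ M.E, ∀ f ∈ M.E, e ≠ f → M.eRk {e, f} = 2) ∧ M.eRank = (p : ℕ∞) ∧ (∀ e, ¬ M.IsColoop e) ∧
    (∀ e ∈ M.E, ∃ A ⊆ M.E \ {e}, e ∉ M.closure A ∧ e ∉ M.closure ((M.E \ {e}) \ A))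

/-- **The per-flat statement of the lane at `(p, 3)`**: on every core matroid of rank `p`, every plane `G` receives
at least `Φ(p, 3) · #U_G` from the middle level under `R₃⁺` (`U_G`, `Yq` as in `PerFlatTransfer.lean`). -/
def R3PlusPerFlat (p : ℕ) : Prop :=
  ∀ {β : Type} [DecidableEq β] (M : Matroid β) [M.Finite], Core M p →
    ∀ G ∈ flatsQ M 3, phiK p 3 * ((UqG M p 3 G).card : ℚ) ≤ ∑ S ∈ Yq M p 3, wPlus M G S

/-- `Φ(p, q) ≥ 0`. -/
theorem phiK_nonneg (p q : ℕ) : 0 ≤ phiK p q := by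
  unfold phiK
  positivity

/-- **C-025 at `q = 3` from the lifted rule.**  If the `(7, 3)` core holds and `R₃⁺` satisfies the per-flat
inequality on every core matroid of every rank `p ≥ 8`, then `C025` holds at `q = 3` for every finite matroid and
every `p ≥ 5` (`(5, 3)` and `(6, 3)` are the tree's `c025_five_three` / `c025_six_three`; the descent to the core is
night-1's `c025_three_of_core`; the per-flat transfer is `c025_of_perFlat_normalized`). -/
theorem c025_three_of_R3Plus {β : Type}
    (hseven : ∀ (M : Matroid β) [M.Finite], Core M 7 → ThmN.RLS M 7 3)
    (hR : ∀ p : ℕ, 8 ≤ p → R3PlusPerFlat p) :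
    ∀ (M : Matroid β) [M.Finite] (p : ℕ), 5 ≤ p → ThmN.RLS M p 3 := by
  apply ThmN.c025_three_of_core
  intro M _ p hp hs hr hc hf
  rcases (show p = 5 ∨ p = 6 ∨ p = 7 ∨ 8 ≤ p by omega) with h | h | h | h
  · subst h
    exact c025_five_three M
  · subst h
    classical
    exact SixThree.c025_six_three M
  · subst h
    exact hseven M ⟨hs, hr, hc, hf⟩
  · classical
    unfold ThmN.RLS
    exact c025_of_perFlat_normalized M p 3 (phiK_nonneg p 3) (fPlus M) (fPlus_nonneg M)
      (hR p h M ⟨hs, hr, hc, hf⟩)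

/-! ### The share bounds -/

/-- Every independent triple of `S ⊆ E` lies in exactly one plane (its closure): `Σ_G ρ₃(G ∩ S) = ρ₃(S)`. -/
theorem sum_rho3_inter {S : Finset α} (hS : S ⊆ gr M) :
    ∑ G ∈ flatsQ M 3, rho3 M (G ∩ S) = rho3 M S := by
  classical
  symm
  unfold rho3
  rw [Finset.card_eq_sum_card_fiberwise (f := fun T => clF M T) (t := flatsQ M 3) ?_]
  · apply Finset.sum_congr rfl
    intro G hG
    congr 1
    ext T
    simp only [Finset.mem_filter, Finset.mem_powersetCard]
    constructor
    · rintro ⟨⟨⟨hTS, hTc⟩, hTi⟩, hcl⟩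
      have h3 : M.eRk (T : Set α) = 3 := eRk_eq_three_of_indep_card hTi hTc
      refine ⟨⟨Finset.subset_inter ?_ hTS, hTc⟩, hTi⟩
      rw [← hcl]
      exact (clF_mem_planes (hTS.trans hS) h3).2
    · rintro ⟨⟨hTG, hTc⟩, hTi⟩
      have h3 : M.eRk (T : Set α) = 3 := eRk_eq_three_of_indep_card hTi hTc
      refine ⟨⟨⟨hTG.trans Finset.inter_subset_right, hTc⟩, hTi⟩, ?_⟩
      rw [flatsQ_three] at hG
      apply Finset.coe_injective
      rw [coe_clF]
      exact closure_eq_of_subset_plane hG (hTG.trans Finset.inter_subset_left) h3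
  · intro T hT
    rw [Finset.mem_coe, Finset.mem_filter, Finset.mem_powersetCard] at hT
    rw [Finset.mem_coe, flatsQ_three]
    exact (clF_mem_planes (hT.1.1.trans hS) (eRk_eq_three_of_indep_card hT.2 hT.1.2)).1

/-- With no trace outside `𝒯₀`, the weight is `ρ₃(G ∩ S)`. -/
theorem fPlus_of_mstar_zero {S : Finset α} (h : mstar M S = 0) (G : Finset α) :
    fPlus M G S = (rho3 M (G ∩ S) : ℚ) := by
  unfold fPlus
  rw [if_pos h]

/-- With no trace outside `𝒯₀`, the total weight of `S` is `ρ₃(S)`. -/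
theorem sum_fPlus_of_mstar_zero {S : Finset α} (hS : S ⊆ gr M) (h : mstar M S = 0) :
    ∑ G ∈ flatsQ M 3, fPlus M G S = (rho3 M S : ℚ) := by
  rw [Finset.sum_congr rfl (fun G _ => fPlus_of_mstar_zero h G), ← Nat.cast_sum, sum_rho3_inter hS]

/-- **The `𝒯₀` share bound.**  With no trace outside `𝒯₀` (the basis-count rule `R₃`), every plane `G` receives
at least `ρ₃(G ∩ S) / C(|S|, 3)` from `S`. -/
theorem wPlus_ge_of_mstar_zero {S : Finset α} (hS : S ⊆ gr M) (h : mstar M S = 0) (G : Finset α) :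
    (rho3 M (G ∩ S) : ℚ) / (S.card.choose 3 : ℚ) ≤ wPlus M G S := by
  unfold wPlus
  rw [sum_fPlus_of_mstar_zero hS h, fPlus_of_mstar_zero h]
  rcases Nat.eq_zero_or_pos (rho3 M (G ∩ S)) with h0 | hpos
  · rw [h0]
    simp
  · have hSpos : 0 < rho3 M S := hpos.trans_le (rho3_mono Finset.inter_subset_right)
    exact div_le_div_of_nonneg_left (by positivity) (by exact_mod_cast hSpos)
      (by exact_mod_cast rho3_le_choose S)

/-- The pure-form share of the lane: with no trace outside `𝒯₀`, a subset `B′ ⊆ G ∩ S` guarantees the plane `G` the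
share `ρ₃(B′) / C(|S|, 3)` in `S`. -/
theorem wPlus_ge_of_subset_of_mstar_zero {S : Finset α} (hS : S ⊆ gr M) (h : mstar M S = 0)
    {G B : Finset α} (hB : B ⊆ G ∩ S) :
    (rho3 M B : ℚ) / (S.card.choose 3 : ℚ) ≤ wPlus M G S :=
  le_trans (div_le_div_of_nonneg_right (by exact_mod_cast rho3_mono hB) (by positivity))
    (wPlus_ge_of_mstar_zero hS h G)

open scoped Classical in
/-- The tied planes of `S`: non-`𝒯₀` traces of the largest size. -/
noncomputable def tied (M : Matroid α) [M.Finite] (S : Finset α) : Finset (Finset α) :=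
  (flatsQ M 3).filter (fun G => NonT0 M (G ∩ S) ∧ (G ∩ S).card = mstar M S)

open scoped Classical in
/-- Membership in `tied`. -/
theorem mem_tied {S G : Finset α} :
    G ∈ tied M S ↔ G ∈ flatsQ M 3 ∧ NonT0 M (G ∩ S) ∧ (G ∩ S).card = mstar M S := by
  unfold tied
  rw [Finset.mem_filter]

/-- A tied plane has a non-`𝒯₀` trace, so `m* > 0`. -/
theorem mstar_pos_of_mem_tied {S G : Finset α} (hG : G ∈ tied M S) : 0 < mstar M S := by
  rw [mem_tied] at hG
  rw [← hG.2.2]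
  exact lt_of_lt_of_le (by norm_num) (three_le_card_of_eRk_eq_three hG.2.1.1)

open scoped Classical in
/-- With a trace outside `𝒯₀`, the weight of a plane is `ρ₃(G ∩ S)` on the tied planes and `0` elsewhere. -/
theorem fPlus_of_mstar_pos {S : Finset α} (h : 0 < mstar M S) (G : Finset α) :
    fPlus M G S = if NonT0 M (G ∩ S) ∧ (G ∩ S).card = mstar M S then (rho3 M (G ∩ S) : ℚ) else 0 := by
  unfold fPlus
  rw [if_neg h.ne']

/-- With a trace outside `𝒯₀`, the total weight of `S` is the `ρ₃` of its tied planes. -/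
theorem sum_fPlus_of_mstar_pos {S : Finset α} (h : 0 < mstar M S) :
    ∑ G ∈ flatsQ M 3, fPlus M G S = ∑ G ∈ tied M S, (rho3 M (G ∩ S) : ℚ) := by
  classical
  unfold tied
  rw [Finset.sum_filter]
  exact Finset.sum_congr rfl (fun G _ => fPlus_of_mstar_pos h G)

/-- **The winner share.**  A plane whose trace is the UNIQUE largest non-`𝒯₀` trace of `S` receives the whole of
`S`: `w⁺(G, S) = 1`. -/
theorem wPlus_eq_one_of_unique {S G : Finset α} (hS : S ⊆ gr M) (hG : G ∈ tied M S)
    (huniq : ∀ G' ∈ tied M S, G' = G) : wPlus M G S = 1 := by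
  have hpos : 0 < mstar M S := mstar_pos_of_mem_tied hG
  have hsingle : tied M S = {G} := by
    ext G'
    rw [Finset.mem_singleton]
    exact ⟨fun h => huniq G' h, fun h => h ▸ hG⟩
  have hG' := mem_tied.1 hG
  have hr : 0 < rho3 M (G ∩ S) :=
    rho3_pos_of_eRk_eq_three (Finset.inter_subset_right.trans hS) hG'.2.1.1
  unfold wPlus
  rw [sum_fPlus_of_mstar_pos hpos, hsingle, Finset.sum_singleton, fPlus_of_mstar_pos hpos,
    if_pos hG'.2]
  exact div_self (by exact_mod_cast hr.ne')

/-- **The tie share.**  A tied plane whose `ρ₃` is at least that of every other tied plane receives at least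
`1 / #tied` of `S` (the near-pencil tie `1/(x + 1)` of the lane). -/
theorem wPlus_ge_of_tie {S G : Finset α} (hS : S ⊆ gr M) (hG : G ∈ tied M S)
    (hle : ∀ G' ∈ tied M S, rho3 M (G' ∩ S) ≤ rho3 M (G ∩ S)) :
    1 / ((tied M S).card : ℚ) ≤ wPlus M G S := by
  have hpos : 0 < mstar M S := mstar_pos_of_mem_tied hG
  have hG' := mem_tied.1 hG
  have hr : 0 < rho3 M (G ∩ S) :=
    rho3_pos_of_eRk_eq_three (Finset.inter_subset_right.trans hS) hG'.2.1.1
  have hcard : 0 < (tied M S).card := Finset.card_pos.2 ⟨G, hG⟩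
  have hsum : ∑ G' ∈ tied M S, (rho3 M (G' ∩ S) : ℚ) ≤ ((tied M S).card : ℚ) * (rho3 M (G ∩ S) : ℚ) := by
    have := Finset.sum_le_card_nsmul (tied M S) (fun G' => (rho3 M (G' ∩ S) : ℚ)) (rho3 M (G ∩ S) : ℚ)
      (fun G' hG'' => by exact_mod_cast hle G' hG'')
    rwa [nsmul_eq_mul] at this
  have hsumpos : 0 < ∑ G' ∈ tied M S, (rho3 M (G' ∩ S) : ℚ) :=
    Finset.sum_pos' (fun G' _ => by positivity) ⟨G, hG, by exact_mod_cast hr⟩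
  unfold wPlus
  rw [sum_fPlus_of_mstar_pos hpos, fPlus_of_mstar_pos hpos, if_pos hG'.2]
  rw [div_le_div_iff₀ (by exact_mod_cast hcard) hsumpos]
  calc (1 : ℚ) * ∑ G' ∈ tied M S, (rho3 M (G' ∩ S) : ℚ)
      ≤ ((tied M S).card : ℚ) * (rho3 M (G ∩ S) : ℚ) := by rw [one_mul]; exact hsum
    _ = (rho3 M (G ∩ S) : ℚ) * ((tied M S).card : ℚ) := mul_comm _ _

/-- `m*(S) = 0` exactly when no plane meets `S` in a trace outside `𝒯₀`. -/
theorem mstar_eq_zero_iff {S : Finset α} :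
    mstar M S = 0 ↔ ∀ G ∈ flatsQ M 3, ¬ NonT0 M (G ∩ S) := by
  classical
  unfold mstar
  rw [← Nat.bot_eq_zero, Finset.sup_eq_bot_iff]
  constructor
  · intro h G hG hn
    have := h G (Finset.mem_filter.2 ⟨hG, hn⟩)
    rw [Nat.bot_eq_zero] at this
    have h3 := three_le_card_of_eRk_eq_three hn.1
    omega
  · intro h G hG
    rw [Finset.mem_filter] at hG
    exact absurd hG.2 (h G hG.1)

end NightThree

end PercRepro
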